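import Mathlib

/-!
# Crux `UniformPhotonSphereChannelsR` (K1R, stmt-FinalStateConjecture-14074), line
# `crum-peeling-recessive-tower` — Theorem A support: the exact shift law (mode `n = 1`)

For the coefficient arrays of skeleton v4 (`stub_coeffExists` / `stub_coeffMajorant`: `Ω k 0 = G k 0 = 1`,
inversion relation, rung-0 identity, rung maps) the order-`w` balance is EXACT and linear:
`Ω 0 1 = ((1 − s²) − ℓ²)/(ℓ(ℓ+1))` and `Ω (k+1) 1 = Ω k 1 + 1/(ℓ−k) + 1/(ℓ−k−1)` (c1's shift law
`a_{k+1} = a_k + 1/λ + 1/(λ−1)`, `a_k = 1 − G k 1 = 1 + Ω k 1`), whence the closed form, `G k 1 = −Ω k 1`,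
and the mode-1 clause of `stub_coeffMajorant` with the explicit constant
`|Ω k 1|, |G k 1| ≤ 4(1 + log(ℓ+1))` (harmonic sum `≤ 1 + log`).  This is where the log-ball enters.
-/

-- `Summit.<S>.<S>` repeats a namespace component by design (D-0017); off here as in the lakefile.
set_option linter.dupNamespace false

noncomputable section

open Finset

namespace Summit.FinalStateConjecture.FinalStateConjecture.Theorems.CrumPeelingRecessiveTower

namespace ShiftLaw

/-- The partial double-harmonic sum is at most `2(1 + log(ℓ+1))`:
`Σ_{j<k} (1/(ℓ−j) + 1/(ℓ−j−1)) ≤ 2(1 + log(ℓ+1))` for `k + 1 ≤ ℓ`. -/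
theorem sum_shift_le (ℓ k : ℕ) (hk : k + 1 ≤ ℓ) :
    ∑ j ∈ Finset.range k, (1 / ((ℓ : ℝ) - j) + 1 / ((ℓ : ℝ) - j - 1))
      ≤ 2 * (1 + Real.log ((ℓ : ℝ) + 1)) := by
  -- extend to `k = ℓ − 1`, bound each term by `2/(ℓ−j−1)`, reflect, and use the harmonic bound
  have hnonneg : ∀ j ∈ range (ℓ - 1), 0 ≤ 1 / ((ℓ : ℝ) - j) + 1 / ((ℓ : ℝ) - j - 1) := by
    intro j hj
    have hj' : j < ℓ - 1 := mem_range.1 hj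
    have h1 : (j : ℝ) + 2 ≤ ℓ := by
      have : j + 2 ≤ ℓ := by omega
      exact_mod_cast this
    have : 0 < (ℓ : ℝ) - j := by linarith
    have : 0 < (ℓ : ℝ) - j - 1 := by linarith
    positivity
  have hkℓ : k ≤ ℓ - 1 := Nat.le_sub_one_of_lt hk
  have hsub : range k ⊆ range (ℓ - 1) := Finset.range_subset_range.2 hkℓ
  calc ∑ j ∈ range k, (1 / ((ℓ : ℝ) - j) + 1 / ((ℓ : ℝ) - j - 1))
      ≤ ∑ j ∈ range (ℓ - 1), (1 / ((ℓ : ℝ) - j) + 1 / ((ℓ : ℝ) - j - 1)) :=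
        sum_le_sum_of_subset_of_nonneg hsub (fun j hj _ => hnonneg j hj)
    _ ≤ ∑ j ∈ range (ℓ - 1), 2 / ((((ℓ - 1 - 1 - j : ℕ) : ℝ)) + 1) := by
        refine sum_le_sum fun j hj => ?_
        have hj' : j < ℓ - 1 := mem_range.1 hj
        have hcast : (((ℓ - 1 - 1 - j : ℕ) : ℝ)) + 1 = (ℓ : ℝ) - j - 1 := by
          rw [Nat.cast_sub (by omega), Nat.cast_sub (by omega), Nat.cast_sub (by omega)]
          push_cast
          ring
        rw [hcast]
        have h1 : (j : ℝ) + 2 ≤ ℓ := by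
          have : j + 2 ≤ ℓ := by omega
          exact_mod_cast this
        have hp : 0 < (ℓ : ℝ) - j - 1 := by linarith
        have hle : 1 / ((ℓ : ℝ) - j) ≤ 1 / ((ℓ : ℝ) - j - 1) :=
          one_div_le_one_div_of_le hp (by linarith)
        calc 1 / ((ℓ : ℝ) - j) + 1 / ((ℓ : ℝ) - j - 1) ≤ 1 / ((ℓ : ℝ) - j - 1) + 1 / ((ℓ : ℝ) - j - 1) :=
              add_le_add hle le_rfl
          _ = 2 / ((ℓ : ℝ) - j - 1) := by ring
    _ = ∑ j ∈ range (ℓ - 1), 2 / ((j : ℝ) + 1) :=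
        sum_range_reflect (fun j => 2 / ((j : ℝ) + 1)) (ℓ - 1)
    _ = 2 * (harmonic (ℓ - 1) : ℝ) := by
        rw [harmonic, Rat.cast_sum, mul_sum]
        refine sum_congr rfl fun j _ => ?_
        push_cast
        ring
    _ ≤ 2 * (1 + Real.log ((ℓ - 1 : ℕ) : ℝ)) :=
        mul_le_mul_of_nonneg_left (harmonic_le_one_add_log _) (by norm_num)
    _ ≤ 2 * (1 + Real.log ((ℓ : ℝ) + 1)) := by
        have hℓ1 : ((ℓ - 1 : ℕ) : ℝ) ≤ (ℓ : ℝ) + 1 := by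
          have : ((ℓ - 1 : ℕ) : ℝ) ≤ ℓ := by exact_mod_cast Nat.sub_le ℓ 1
          linarith
        rcases Nat.eq_zero_or_pos (ℓ - 1) with h0 | hpos
        · rw [h0]
          simp only [Nat.cast_zero, Real.log_zero, add_zero]
          have : 0 ≤ Real.log ((ℓ : ℝ) + 1) := Real.log_nonneg (by
            have : (0 : ℝ) ≤ ℓ := Nat.cast_nonneg ℓ
            linarith)
          linarith
        · have hpos' : (0 : ℝ) < ((ℓ - 1 : ℕ) : ℝ) := by exact_mod_cast hpos
          have := Real.log_le_log hpos' hℓ1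
          linarith

end ShiftLaw

open ShiftLaw

/-- **Exact shift law and the mode-1 clause** (registered sub-goal `coeffMajorant_shiftLaw` of
`stub_coeffMajorant`, verbatim signature).  For the coefficient arrays of skeleton v4:
`Ω k 1 = ((1 − s²) − ℓ²)/(ℓ(ℓ+1)) + Σ_{j<k} (1/(ℓ−j) + 1/(ℓ−j−1))`, `G k 1 = −Ω k 1`, and
`|Ω k 1|, |G k 1| ≤ 4(1 + log(ℓ+1))` for every rung `k ≤ ℓ − 1`. -/
theorem coeffMajorant_shiftLaw : ∀ (s ℓ : ℕ), s ≤ 2 → 1 ≤ ℓ → ∀ (Ω G : ℕ → ℕ → ℝ), (∀ k, Ω k 0 = 1) → (∀ k, G k 0 = 1) → (∀ k n, ∑ i ∈ Finset.range (n + 1), G k i * Ω k (n - i) = if n = 0 then 1 else 0) → (∀ n, (ℓ : ℝ) ^ 2 * ∑ i ∈ Finset.range (n + 1), Ω 0 i * Ω 0 (n - i) + (ℓ : ℝ) * (((n : ℝ) + 1) * Ω 0 n - 2 * (n : ℝ) * Ω 0 (n - 1)) = (if n = 0 then (ℓ : ℝ) * ((ℓ : ℝ) + 1) else if n = 1 then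 2 * (1 - (s : ℝ) ^ 2) - 2 * ((ℓ : ℝ) * ((ℓ : ℝ) + 1)) else if n = 2 then -(4 * (1 - (s : ℝ) ^ 2)) else 0)) → (∀ k, k + 2 ≤ ℓ → ∀ n, ((ℓ : ℝ) - k - 1) ^ 2 * ∑ i ∈ Finset.range (n + 1), Ω (k + 1) i * Ω (k + 1) (n - i) + ((ℓ : ℝ) - k - 1) * (((n : ℝ) + 1) * Ω (k + 1) n - 2 * (n : ℝ) * Ω (k + 1) (n - 1)) = ((ℓ : ℝ) - k) ^ 2 * ∑ i ∈ Finset.range (n + 1), Ω k i * Ω k (n - i) - ((ℓ : ℝ) - k) * (((n : ℝ) + 1) * Ω k n - 2 * (n : ℝ) * Ω k (n - 1))) → ∀ k, k + 1 ≤ ℓ → Ω k 1 = ((1 - (s : ℝ) ^ 2) - (ℓ : ℝ) ^ 2) / ((ℓ : ℝ) * ((ℓ : ℝ) + 1)) + ∑ j ∈ Finset.range k, (1 / ((ℓ : ℝ) - j) + 1 / ((ℓ : ℝ) - j - 1)) ∧ G k 1 = -Ω k 1 ∧ |Ω k 1| ≤ 4 * (1 + Real.log ((ℓ : ℝ) +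 1)) ∧ |G k 1| ≤ 4 * (1 + Real.log ((ℓ : ℝ) + 1)) := by
  intro s ℓ hs hℓ Ω G hΩ0 hG0 hinv H0 Hk
  have hℓr : (1 : ℝ) ≤ ℓ := by exact_mod_cast hℓ
  have hL : 0 < (ℓ : ℝ) * ((ℓ : ℝ) + 1) := by positivity
  -- order `w` of rung 0
  have h01 : Ω 0 1 = ((1 - (s : ℝ) ^ 2) - (ℓ : ℝ) ^ 2) / ((ℓ : ℝ) * ((ℓ : ℝ) + 1)) := by
    have h := H0 1
    simp only [sum_range_succ, sum_range_zero, hΩ0, Nat.sub_zero, Nat.sub_self, Nat.cast_one,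
      one_ne_zero, if_false, if_true, zero_add, mul_one, one_mul] at h
    rw [eq_div_iff hL.ne']
    linear_combination (1 / 2 : ℝ) * h
  -- order `w` of the rung map
  have hstep : ∀ k, k + 2 ≤ ℓ → Ω (k + 1) 1 = Ω k 1 + (1 / ((ℓ : ℝ) - k) + 1 / ((ℓ : ℝ) - k - 1)) := by
    intro k hk
    have h := Hk k hk 1
    simp only [sum_range_succ, sum_range_zero, hΩ0, Nat.sub_zero, Nat.sub_self, Nat.cast_one,
      zero_add, mul_one, one_mul] at h
    have hk' : (k : ℝ) + 2 ≤ ℓ := by exact_mod_cast hk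
    have hne1 : (ℓ : ℝ) - k ≠ 0 := by intro h0; linarith
    have hne2 : (ℓ : ℝ) - k - 1 ≠ 0 := by intro h0; linarith
    have key : (Ω (k + 1) 1 - Ω k 1) * (((ℓ : ℝ) - k) * ((ℓ : ℝ) - k - 1))
        = ((ℓ : ℝ) - k - 1) + ((ℓ : ℝ) - k) := by
      linear_combination (1 / 2 : ℝ) * h
    have : Ω (k + 1) 1 - Ω k 1 = 1 / ((ℓ : ℝ) - k) + 1 / ((ℓ : ℝ) - k - 1) := by
      rw [div_add_div _ _ hne1 hne2, eq_div_iff (mul_ne_zero hne1 hne2)]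
      linarith [key]
    linarith
  -- closed form by induction on `k`
  have hclosed : ∀ k, k + 1 ≤ ℓ → Ω k 1 = ((1 - (s : ℝ) ^ 2) - (ℓ : ℝ) ^ 2) / ((ℓ : ℝ) * ((ℓ : ℝ) + 1))
      + ∑ j ∈ Finset.range k, (1 / ((ℓ : ℝ) - j) + 1 / ((ℓ : ℝ) - j - 1)) := by
    intro k
    induction k with
    | zero => intro _; simp [h01]
    | succ k ih =>
      intro hk
      rw [hstep k (by omega), ih (by omega), sum_range_succ]
      ring
  -- the inverse series at order `w`
  have hG1 : ∀ k, G k 1 = -Ω k 1 := by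
    intro k
    have h := hinv k 1
    simp only [sum_range_succ, sum_range_zero, hG0, hΩ0, Nat.sub_zero, Nat.sub_self, one_ne_zero,
      if_false, zero_add, mul_one, one_mul] at h
    linarith
  -- the bound
  have hhead : |((1 - (s : ℝ) ^ 2) - (ℓ : ℝ) ^ 2) / ((ℓ : ℝ) * ((ℓ : ℝ) + 1))| ≤ 2 := by
    rw [abs_div, abs_of_pos hL, div_le_iff₀ hL]
    have hs' : (s : ℝ) ≤ 2 := by exact_mod_cast hs
    have hs0 : (0 : ℝ) ≤ s := Nat.cast_nonneg s
    have h1 : |(1 - (s : ℝ) ^ 2) - (ℓ : ℝ) ^ 2| ≤ (ℓ : ℝ) ^ 2 + 3 := by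
      rw [abs_le]; constructor <;> nlinarith
    nlinarith
  have hlog : 0 ≤ Real.log ((ℓ : ℝ) + 1) := Real.log_nonneg (by linarith)
  intro k hk
  have hsum := sum_shift_le ℓ k hk
  have hsum0 : 0 ≤ ∑ j ∈ Finset.range k, (1 / ((ℓ : ℝ) - j) + 1 / ((ℓ : ℝ) - j - 1)) := by
    refine sum_nonneg fun j hj => ?_
    have hj' : j < k := mem_range.1 hj
    have h1 : (j : ℝ) + 2 ≤ ℓ := by
      have : j + 2 ≤ ℓ := by omega
      exact_mod_cast this
    have : 0 < (ℓ : ℝ) - j := by linarith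
    have : 0 < (ℓ : ℝ) - j - 1 := by linarith
    positivity
  have hΩ1 : |Ω k 1| ≤ 4 * (1 + Real.log ((ℓ : ℝ) + 1)) := by
    rw [hclosed k hk]
    calc |((1 - (s : ℝ) ^ 2) - (ℓ : ℝ) ^ 2) / ((ℓ : ℝ) * ((ℓ : ℝ) + 1))
          + ∑ j ∈ Finset.range k, (1 / ((ℓ : ℝ) - j) + 1 / ((ℓ : ℝ) - j - 1))|
        ≤ |((1 - (s : ℝ) ^ 2) - (ℓ : ℝ) ^ 2) / ((ℓ : ℝ) * ((ℓ : ℝ) + 1))|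
          + |∑ j ∈ Finset.range k, (1 / ((ℓ : ℝ) - j) + 1 / ((ℓ : ℝ) - j - 1))| := abs_add_le _ _
      _ ≤ 2 + 2 * (1 + Real.log ((ℓ : ℝ) + 1)) := by
          rw [abs_of_nonneg hsum0]; exact add_le_add hhead hsum
      _ ≤ 4 * (1 + Real.log ((ℓ : ℝ) + 1)) := by linarith
  refine ⟨hclosed k hk, hG1 k, hΩ1, ?_⟩
  rw [hG1 k, abs_neg]
  exact hΩ1

end Summit.FinalStateConjecture.FinalStateConjecture.Theorems.CrumPeelingRecessiveTower

end
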